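import Summits.ResolutionOfSingularities.ResolutionOfSingularities.Theorems.PurelyInseparableDim4JointWaitingNodeDefsTwo
import Summits.ResolutionOfSingularities.ResolutionOfSingularities.Theorems.PurelyInseparableDim4JointWaitingStepSees
import HarnessLib

/-!
# Purely inseparable four-folds: the HOST half of the threading node step — children and waiting kids as `MemberData` (brick S3 (c)
# «joint point∘coordinate chains», part 52 = v3 threading, host step; cell `res-dim4-pi`)

[OURS · counted 0] (D-0157 DOOR 2; desk WORD #66 (4)(c), #74 (g), #99 (d); frame `PIDim4.TerminationImpliesOrderReduction`, S3 (c) v3;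
host item stmt-ResolutionOfSingularities-16155, helper). Nothing here proves resolution of singularities in dimension ≥ 4 / characteristic
`p` — NOT here, not anywhere in this programme.

The host half of the threading node step (memo `S3c-V3LITE-LANDED.md`, item 4) against part 49/49b's names: a member `c₁` of a node
`(X′, M′)` carrying `MemberData` (state `s`, centre `S`, waiting entries `Wt` with regions `wr`) is blown up; part 37e's step (through typ-2's
comparison `ε` with the model blow-up) yields its CHILDREN and WAITING KIDS, and this file repackages them as `MemberData` of the new stage with
EMPTY waiting sets (their own-node block is the two-way block inherited hereditarily), together with the facts the points side and the
induction need: children lie over `c₁`, waiting kids lie over their regions, all pairwise disjoint, the THREE-WAY cover of the closed order-`p`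
points over `c₁`, the cover of those over a waiting region OFF `c₁`, and the finiteness of the leaf points.

* **`memberData_host_step`**.

AI-produced formalisation, weaker than expert review. bears_on: LADDER-RESOLUTION:D157-DOOR2 (res-dim4-pi · S3 (c) joint v3 · threading).
-/

set_option linter.dupNamespace false -- D-0017: single-problem summit path `Summit.<S>.<S>.…` by design

noncomputable section

open MvPolynomial Finset CategoryTheory AlgebraicGeometry Opposite TopologicalSpace
open AlgebraicGeometry.Scheme.IdealSheafData (ofIdealTop vanishingIdeal)

namespace Summit.ResolutionOfSingularities.ResolutionOfSingularities.Theorems.PIDim4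

open Literature.AlgebraicGeometry.Resolution
open Literature.AlgebraicGeometry.Resolution.Hauser2010
open Literature.AlgebraicGeometry.Resolution.AffinePointBlowup (P A γ coord Wtop ξ)

namespace Equimultiple

section HostStep

variable {K : Type} [Field K] {p : ℕ} [hp : Fact p.Prime] [CharP K p] [DecidableEq K]
variable {X' : Scheme.{0}}

/-- **THE HOST HALF OF THE THREADING NODE STEP.** See the module docstring. `Ce = 𝓘(c₁)`, `π = Bl_{Ce}`, `M″ = M′.transform π Ce`.
[cite: BierstoneGrigorievMilmanWlodarczyk2011, Def. 3.1.3; §4 Step 2b] [cite: Hauser2010, §§F–G] [cite: GortzWedhorn2020, Prop. 13.91] -/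
theorem memberData_host_step [IsAlgClosed K] [IsLocallyNoetherian X'] (M' : MarkedIdeal X') (hmult : M'.mult = p)
    (plan : State K → Finset (Fin 4) → Finset (Fin 4 × (Fin 4 → K) × Finset (Fin 4)))
    (leaves : State K → Finset (Fin 4) → Finset (Fin 4 × (Fin 4 → K))) (c₁ : Closeds X') {s : State K} {S : Finset (Fin 4)}
    {Wt : Finset (Fin 4 × (Fin 4 → K) × Finset (Fin 4))} {wr : Fin 4 × (Fin 4 → K) × Finset (Fin 4) → Closeds X'}
    (h : MemberData p plan leaves M' c₁ s S Wt wr) :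
    ∃ kid wkid : Fin 4 × (Fin 4 → K) × Finset (Fin 4) → Closeds (blowup (vanishingIdeal c₁)),
      (∀ e ∈ plan s S,
        MemberData p plan leaves (M'.transform (blowup.π (vanishingIdeal c₁)) (vanishingIdeal c₁)) (kid e)
          (CentreBlowup.step p S e.1 e.2.1 s) e.2.2 ∅ (fun _ => ⊥) ∧
        (kid e : Set (blowup (vanishingIdeal c₁))) ⊆ blowup.π (vanishingIdeal c₁) ⁻¹' (c₁ : Set X') ∧
        (kid e : Set (blowup (vanishingIdeal c₁))).Nonempty) ∧
      (∀ wt ∈ Wt,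
        MemberData p plan leaves (M'.transform (blowup.π (vanishingIdeal c₁)) (vanishingIdeal c₁)) (wkid wt)
          (CentreBlowup.step p S wt.1 wt.2.1 s) wt.2.2 ∅ (fun _ => ⊥) ∧
        (wkid wt : Set (blowup (vanishingIdeal c₁))) ⊆ blowup.π (vanishingIdeal c₁) ⁻¹' (wr wt : Set X') ∧
        (wkid wt : Set (blowup (vanishingIdeal c₁))).Nonempty) ∧
      (∀ e ∈ plan s S, ∀ e' ∈ plan s S, e ≠ e' →
        Disjoint (kid e : Set (blowup (vanishingIdeal c₁))) (kid e' : Set (blowup (vanishingIdeal c₁)))) ∧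
      (∀ e ∈ plan s S, ∀ wt ∈ Wt,
        Disjoint (kid e : Set (blowup (vanishingIdeal c₁))) (wkid wt : Set (blowup (vanishingIdeal c₁)))) ∧
      (∀ wt ∈ Wt, ∀ wt' ∈ Wt, wt ≠ wt' →
        Disjoint (wkid wt : Set (blowup (vanishingIdeal c₁))) (wkid wt' : Set (blowup (vanishingIdeal c₁)))) ∧
      (∀ w : blowup (vanishingIdeal c₁), IsClosed ({w} : Set (blowup (vanishingIdeal c₁))) →
        blowup.π (vanishingIdeal c₁) w ∈ (c₁ : Set X') →
        (p : ℕ∞) ≤ idealOrder (M'.transform (blowup.π (vanishingIdeal c₁)) (vanishingIdeal c₁)).ideal w →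
        (∃ e ∈ plan s S, w ∈ (kid e : Set (blowup (vanishingIdeal c₁)))) ∨
        (∃ wt ∈ Wt, w ∈ (wkid wt : Set (blowup (vanishingIdeal c₁)))) ∨
        ∃ l ∈ leaves s S, l.1 ∈ S ∧ l.2 l.1 = 0 ∧ CentreBlowup.IsEquimultiplePoint p S l.1 l.2 s ∧
          ∃ (Y' : Scheme.{0}) (φ' : Y' ⟶ blowup (vanishingIdeal c₁)) (ψ' : Y' ⟶ P 4 K) (_ : IsOpenImmersion φ')
            (_ : IsOpenImmersion ψ') (y' : Y'), φ' y' = w ∧ ψ' y' = ξ 4 K ∧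
            (M'.transform (blowup.π (vanishingIdeal c₁)) (vanishingIdeal c₁)).ideal.comap φ' =
              (hypSheaf p (CentreBlowup.step p S l.1 l.2 s).F).comap ψ') ∧
      (∀ w : blowup (vanishingIdeal c₁), IsClosed ({w} : Set (blowup (vanishingIdeal c₁))) →
        (p : ℕ∞) ≤ idealOrder (M'.transform (blowup.π (vanishingIdeal c₁)) (vanishingIdeal c₁)).ideal w →
        blowup.π (vanishingIdeal c₁) w ∉ (c₁ : Set X') →
        ∀ wt ∈ Wt, blowup.π (vanishingIdeal c₁) w ∈ (wr wt : Set X') → w ∈ (wkid wt : Set (blowup (vanishingIdeal c₁)))) ∧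
      {w : blowup (vanishingIdeal c₁) | IsClosed ({w} : Set (blowup (vanishingIdeal c₁))) ∧
        blowup.π (vanishingIdeal c₁) w ∈ (c₁ : Set X') ∧
        (p : ℕ∞) ≤ idealOrder (M'.transform (blowup.π (vanishingIdeal c₁)) (vanishingIdeal c₁)).ideal w ∧
        (∀ e ∈ plan s S, w ∉ (kid e : Set (blowup (vanishingIdeal c₁)))) ∧
        ∀ wt ∈ Wt, w ∉ (wkid wt : Set (blowup (vanishingIdeal c₁)))}.Finite := by
  classical
  obtain ⟨hF, hclean, hS, hreg, hsnc, hchart, hown, hbelow, hacc, hwait, hW2, hPW⟩ := h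
  obtain ⟨Y, φ, ψ, _, _, hM, hZ, hcφ, hsee, ⟨idx, cst_, hshape, hinj⟩, hregions⟩ := hchart
  obtain ⟨hP1, hP2, hP3, hP5⟩ := hown
  set Ce : X'.IdealSheafData := vanishingIdeal c₁ with hCe
  have hπ : IsBlowup (blowup.π Ce) Ce := blowup.isBlowup Ce
  haveI : IsProper (blowup.π Ce) := hπ.isProper
  haveI : IsLocallyNoetherian (blowup Ce) := LocallyOfFiniteType.isLocallyNoetherian (blowup.π Ce)
  have himg := coe_member_eq_image φ ψ c₁ hZ hcφ
  have hT : IsClosed (φ '' (ψ ⁻¹' (AffineCoordBlowup.CΛ 4 K (insert 0 (Fin.succ '' (S : Set (Fin 4)))) : Set (P 4 K)))) :=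
    himg ▸ c₁.isClosed
  -- the model and the comparison
  set B := blowup.π (AffineCoordBlowup.𝓘Λ 4 K (insert 0 (Fin.succ '' (S : Set (Fin 4))))) with hBdef
  have hB : IsBlowup B (AffineCoordBlowup.𝓘Λ 4 K (insert 0 (Fin.succ '' (S : Set (Fin 4))))) := blowup.isBlowup _
  obtain ⟨ε, hsq, hC', hKEY⟩ := ChartDictionary.exists_iso_restrict_blowup_zigzag φ ψ _ Ce hZ hπ hB
  have hK := hKEY M'.ideal (hypSheaf p s.F) p hM
  -- the waiting entries: kid-form admissibility and visibility
  have hW1 : ∀ wt ∈ Wt, wt.1 ∈ S ∧ (∀ i ∈ S, wt.2.1 i = 0) ∧ S.erase wt.1 ⊆ wt.2.2 ∧ wt.1 ∉ wt.2.2 ∧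
      IsPermissibleCentre p wt.2.2 (CentreBlowup.step p S wt.1 wt.2.1 s).F := fun wt hwt =>
    ⟨(hwait wt hwt).1, (hwait wt hwt).2.1, (hwait wt hwt).2.2.1, (hwait wt hwt).2.2.2.1, (hwait wt hwt).2.2.2.2.1⟩
  have hWsee : ∀ wt ∈ Wt, {x : P 4 K | ∀ i ∈ wt.2.2, (X i.succ - C (wt.2.1 i) : A 4 K) ∈ x.asIdeal} ⊆ Set.range ψ :=
    fun wt hwt => (hregions wt hwt).2
  have hWc : ∀ wt ∈ Wt, IsClosed (φ '' (ψ ⁻¹' {x : P 4 K | ∀ i ∈ wt.2.2, (X i.succ - C (wt.2.1 i) : A 4 K) ∈ x.asIdeal})) :=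
    fun wt hwt => by
    have h := (hregions wt hwt).1
    rw [show ({x : P 4 K | ∀ i ∈ wt.2.2, (X i.succ - C (wt.2.1 i) : A 4 K) ∈ x.asIdeal}) = waitingSet wt from rfl, ← h]
    exact (wr wt).isClosed
  have hbdW : ∀ wt ∈ Wt, ∀ D ∈ M'.boundary, Disjoint (D.support : Set X')
      (φ '' (ψ ⁻¹' {x : P 4 K | ∀ i ∈ wt.2.2, (X i.succ - C (wt.2.1 i) : A 4 K) ∈ x.asIdeal})) := fun wt hwt D hD => by
    rw [show ({x : P 4 K | ∀ i ∈ wt.2.2, (X i.succ - C (wt.2.1 i) : A 4 K) ∈ x.asIdeal}) = waitingSet wt from rfl, ← (hregions wt hwt).1]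
    exact (hwait wt hwt).2.2.2.2.2.2 D hD
  -- the step
  obtain ⟨kid, wkid, hkid, hwkid, hkdisj, hkw, hww, hkcover, hwcover, hkfin⟩ :=
    joint_forest_step_waiting_sees φ ψ ε Ce hπ hB hsq hC' M' hmult s hK hS hsee hT hsnc idx cst_ hshape hinj (plan s S) hP1 hP2
      Wt hW1 hW2 hPW hWsee hWc hbdW (leaves s S) hP5
  refine ⟨kid, wkid, fun e he => ?_, fun wt hwt => ?_, hkdisj, hkw, hww, fun w hw hwx hord => ?_, fun w hw hord hoff wt hwt hwT => ?_, ?_⟩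
  · -- a child as `MemberData` with no waiting entries
    obtain ⟨hregk, hsnck, hzig, hover, hne⟩ := hkid e he
    obtain ⟨hj, hbj, hsub, heq, hperm''⟩ := hP1 e he
    refine ⟨⟨step_F_ne_zero_of_isClean hj e.2.1 s hF hclean hS.2, isClean_step S e.1 e.2.1 s, hperm'', hregk, hsnck,
      (memberChart_empty_iff p _ _ _ _ _).mpr hzig,
      ownBlock_of_v2Block p plan leaves _ (hbelow _ (Or.inl ⟨e, he, Relation.ReflTransGen.refl⟩)), fun q hq => ?_,
      hacc.inv ⟨e, he, rfl⟩, fun wt hwt => absurd hwt (Finset.notMem_empty wt), fun wt hwt => absurd hwt (Finset.notMem_empty wt),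
      fun e' _ wt hwt => absurd hwt (Finset.notMem_empty wt)⟩, fun w hw => by have h := hover hw; rwa [Set.mem_preimage, himg] at h, hne⟩
    rcases hq with ⟨e', he', hq'⟩ | ⟨wt, hwt, -⟩
    · exact hbelow q (Or.inl ⟨e, he, Relation.ReflTransGen.head ⟨e', he', rfl⟩ hq'⟩)
    · exact absurd hwt (Finset.notMem_empty wt)
  · -- a waiting kid as `MemberData` with no waiting entries
    obtain ⟨hregk, hsnck, hzig, hproj, hne⟩ := hwkid wt hwt
    obtain ⟨hj, hc0, hsub, hjT, hperm'', haccw, -⟩ := hwait wt hwt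
    refine ⟨⟨step_F_ne_zero_of_isClean hj wt.2.1 s hF hclean hS.2, isClean_step S wt.1 wt.2.1 s, hperm'', hregk, hsnck,
      (memberChart_empty_iff p _ _ _ _ _).mpr hzig,
      ownBlock_of_v2Block p plan leaves _ (hbelow _ (Or.inr ⟨wt, hwt, Relation.ReflTransGen.refl⟩)), fun q hq => ?_,
      haccw, fun wt' hwt' => absurd hwt' (Finset.notMem_empty wt'), fun wt' hwt' => absurd hwt' (Finset.notMem_empty wt'),
      fun e' _ wt' hwt' => absurd hwt' (Finset.notMem_empty wt')⟩, fun w hw => ?_, hne⟩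
    · rcases hq with ⟨e', he', hq'⟩ | ⟨wt', hwt', -⟩
      · exact hbelow q (Or.inr ⟨wt, hwt, Relation.ReflTransGen.head ⟨e', he', rfl⟩ hq'⟩)
      · exact absurd hwt' (Finset.notMem_empty wt')
    · rw [Set.mem_preimage, (hregions wt hwt).1]
      exact hproj w hw
  · -- three-way cover over the host
    rw [← himg] at hwx
    exact hkcover w hw hwx hord
  · -- cover off the host over a waiting region
    refine hwcover w hw hord (by rw [himg]; exact hoff) wt hwt ?_
    rw [(hregions wt hwt).1] at hwT
    exact hwT
  · -- finiteness of the leaf points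
    rw [himg] at hkfin
    exact hkfin

end HostStep

end Equimultiple

end Summit.ResolutionOfSingularities.ResolutionOfSingularities.Theorems.PIDim4

end
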